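import Summits.Ventures.HSemireg.WedgeHankelSubstitutionCharpoly
import Summits.Ventures.HSemireg.WedgeHankelSubstitutionGenerators

/-!
# Venture HSemireg — THE GENERAL LINEAR SUBSTITUTION (2h): ITS RESTRICTION TO THE CLASS SPACE AS A LINEAR MAP — in th-7's spike basis `E_0, …, E_n` of `span{E_p} = coSiegel_n` the matrix
# of `Sb g` IS `S_n(g)` (`LinearMap.toMatrix`), hence `det (Sb g|classes) = (det g)^{n(n+1)/2}`, its trace, and for a fixed node `λ₁ ∈ K` its characteristic polynomial
# `Π_{l=0}^{n} (X − (α+λ₁γ)^{n−l}(δ−λ₁γ)^l)` — basis-free invariants of the substitution on th-7's classes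

HONEST FRAMING. Part of the Lean index of the computation cell `pub-hsemireg` (seat p10 gen 19, Sunday typer «UNIFORM-IN-n»).
Finite-dimensional EXTERIOR ALGEBRA + linear algebra ONLY: no variety, no cohomology theory, no sheaf, no Ext group, no semiregularity map;
nothing here says that HC / HC_CM / HC_AV holds; no Literature fact is declared or used.  Custodian versions as in `WedgeHankelSiegelIdeal` (1/3) and `WedgeHankelFrameChange`;
the dictionary (the class space = `Sym^n` of the letters' plane; `det Sym^n(g) = (det g)^{n(n+1)/2}`) is QUOTED, never asserted.

WHAT IS IN THE TREE.  F9 `linearIndependent_w_spike`, `coSiegel_n_eq_span_w_spike` (the `n+1` spike classes `E_p = w_n(δ_p)` are a basis of the class space); H8 `Sb_w_spike_eq_sum`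
(`Sb g (E_p) = Σ_a (S_n)_{a,p} E_a`); I1 `det_sbMat` (`det S_c(g) = (det g)^{c(c+1)/2}`); I9 `charpoly_sbMat_of_fixed_one`, `trace_sbMat_of_fixed_one`, `sbMat_shear_sub_one_pow`.  Everything
so far is stated for the MATRIX `S_n(g)`; THIS FILE packages the restriction of `Sb g` to the class space as a `LinearMap` and reads the invariants basis-free (namespace
`Summit.Ventures.HSemireg.Wedge.HankelFrameChange` continued):
* §193 `spikeSpan n := span{E_p}` (`= coSiegel_n`, `spikeSpan_eq_coSiegel`), th-7's SPIKE BASIS **`spikeBasis : Basis (Fin (n+1)) K (spikeSpan n)`** (`Basis.span`), `Sb_mem_spikeSpan` (stability),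
  the restriction **`SbC α β γ δ : spikeSpan n →ₗ[K] spikeSpan n`** (`SbC_apply_coe`).
* §194 **`toMatrix_SbC`: `LinearMap.toMatrix spikeBasis spikeBasis (SbC g) = S_n(g)`** (H8 in `toMatrix` form); hence **`det_SbC`: `LinearMap.det (SbC g) = (αδ − βγ)^{n(n+1)/2}`** (I1),
  `SbC_isUnit_iff` (`n ≥ 1`: the substitution is invertible on the classes iff `det g ≠ 0`), **`trace_SbC_of_fixed_one`** and **`charpoly_SbC_of_fixed_one`:
  `(SbC g).charpoly = Π_{l} (X − C((α+λ₁γ)^{n−l}(δ−λ₁γ)^l))`** for a fixed node `λ₁ ∈ K` (I9), `charpoly_SbC_shear` (`(X − 1)^{n+1}`).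
NOT typed here: `spikeSpan n` vs `coSiegel K n n` as the SAME submodule inside the statements (they are equal, `spikeSpan_eq_coSiegel`, but the basis lives on the span); minimal polynomial;
anything Ext-side.  New names only.
-/

open Module

namespace Summit.Ventures.HSemireg.Wedge.HankelFrameChange

open Summit.Ventures.HSemireg.Wedge Summit.Ventures.HSemireg.Wedge.Kunneth Summit.Ventures.HSemireg.Wedge.Hankel
  Summit.Ventures.HSemireg.Wedge.BasisFree Summit.Ventures.HSemireg.Wedge.HankelSiegel Summit.Ventures.HSemireg.Wedge.HankelSiegelIdeal
  Summit.Ventures.HSemireg.Wedge.KunnethKernel Summit.Ventures.HSemireg.Wedge.HankelRankOne Summit.Ventures.HSemireg.Wedge.KernelDuality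

variable (K : Type*) [Field K] (n : ℕ)

/-! ## §193. The class space with th-7's spike basis, and the restricted substitution -/

/-- the span of th-7's spike classes `E_0, …, E_n` (= the class space `coSiegel_n`, below). -/
noncomputable def spikeSpan : Submodule K (HT K (In n)) :=
  Submodule.span K (Set.range fun p : Fin (n + 1) => w K n n (fun j => if j = (p : ℕ) then (1 : K) else 0))

variable {n}

/-- `spikeSpan n = coSiegel_n` (F9). -/
theorem spikeSpan_eq_coSiegel : spikeSpan K n = coSiegel K n n := (coSiegel_n_eq_span_w_spike K).symm

/-- every class `w_n(q)` lies in the spike span. -/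
lemma w_mem_spikeSpan (q : ℕ → K) : w K n n q ∈ spikeSpan K n := by
  rw [spikeSpan_eq_coSiegel]; exact w_mem_coSiegel K q

variable (n) in
/-- **TH-7's SPIKE BASIS of the class space** (`E_p = w_n(δ_p)`, `p : Fin (n+1)`; F9's independence). -/
noncomputable def spikeBasis : Basis (Fin (n + 1)) K (spikeSpan K n) := Basis.span (linearIndependent_w_spike K (n := n))

/-- the basis vectors are the spike classes. -/
lemma spikeBasis_coe (p : Fin (n + 1)) : (spikeBasis K n p : HT K (In n)) = w K n n (fun j => if j = (p : ℕ) then (1 : K) else 0) :=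
  Basis.coe_span_apply _ p

/-- **every substitution maps the class space into itself** (`Sb_w`). -/
theorem Sb_mem_spikeSpan (α β γ δ : K) {f : HT K (In n)} (hf : f ∈ spikeSpan K n) : Sb K α β γ δ f ∈ spikeSpan K n := by
  rw [spikeSpan_eq_coSiegel, coSiegel_n_eq_span_w] at hf
  rw [spikeSpan_eq_coSiegel]
  induction hf using Submodule.span_induction with
  | mem x hx => obtain ⟨q, rfl⟩ := hx; rw [Sb_w K α β γ δ le_rfl]; exact w_mem_coSiegel K _
  | zero => rw [map_zero]; exact Submodule.zero_mem _
  | add x y _ _ hx hy => rw [map_add]; exact Submodule.add_mem _ hx hy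
  | smul c x _ hx => rw [map_smul]; exact Submodule.smul_mem _ _ hx

/-- **THE SUBSTITUTION RESTRICTED TO THE CLASS SPACE** as a linear endomorphism of `spikeSpan n`. -/
noncomputable def SbC (α β γ δ : K) : spikeSpan K n →ₗ[K] spikeSpan K n :=
  (Sb K (n := n) α β γ δ).toLinearMap.restrict fun _ hf => Sb_mem_spikeSpan K α β γ δ hf

/-- `SbC` is `Sb` on the underlying forms. -/
@[simp] lemma SbC_apply_coe (α β γ δ : K) (f : spikeSpan K n) : (SbC K α β γ δ f : HT K (In n)) = Sb K α β γ δ (f : HT K (In n)) := rfl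

/-! ## §194. Its matrix is `S_n(g)`: determinant, trace, characteristic polynomial -/

/-- **THE MATRIX OF `Sb g` ON THE CLASS SPACE IN TH-7's SPIKE BASIS IS `S_n(g)`** (H8 `Sb_w_spike_eq_sum` in `LinearMap.toMatrix` form). -/
theorem toMatrix_SbC (α β γ δ : K) : LinearMap.toMatrix (spikeBasis K n) (spikeBasis K n) (SbC K α β γ δ) = sbMat K α β γ δ n (n + 1) := by
  ext a p
  rw [LinearMap.toMatrix_apply]
  have h : SbC K α β γ δ (spikeBasis K n p) = ∑ b : Fin (n + 1), sbMat K α β γ δ n (n + 1) b p • spikeBasis K n b := by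
    apply Subtype.ext
    rw [SbC_apply_coe, spikeBasis_coe, Sb_w_spike_eq_sum, Submodule.coe_sum]
    exact Finset.sum_congr rfl fun b _ => by rw [Submodule.coe_smul, spikeBasis_coe]
  rw [h, Basis.repr_sum_self]

/-- **`det (Sb g | classes) = (αδ − βγ)^{n(n+1)/2}`** (I1 `det_sbMat`; basis-free). -/
theorem det_SbC (α β γ δ : K) : LinearMap.det (SbC K α β γ δ (n := n)) = (α * δ - β * γ) ^ (n * (n + 1) / 2) := by
  rw [← LinearMap.det_toMatrix (spikeBasis K n), toMatrix_SbC, det_sbMat]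

/-- **`n ≥ 1`: the substitution is invertible on the class space iff `αδ − βγ ≠ 0`.** -/
theorem SbC_isUnit_iff (hn : 1 ≤ n) (α β γ δ : K) : IsUnit (SbC K α β γ δ (n := n)) ↔ α * δ - β * γ ≠ 0 := by
  have hpos : 0 < n * (n + 1) / 2 := by
    have : 2 ≤ n * (n + 1) := by nlinarith
    omega
  rw [LinearMap.isUnit_iff_isUnit_det, det_SbC, isUnit_iff_ne_zero]
  exact ⟨fun h hd => h (by rw [hd, zero_pow (Nat.pos_iff_ne_zero.mp hpos)]), fun h => pow_ne_zero _ h⟩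

/-- **the trace for a fixed node `λ₁ ∈ K`: `tr (Sb g | classes) = Σ_l (α+λ₁γ)^{n−l}(δ−λ₁γ)^l`** (I9). -/
theorem trace_SbC_of_fixed_one {α β γ δ l₁ : K} (e₁ : β + l₁ * δ = l₁ * (α + l₁ * γ)) :
    LinearMap.trace K _ (SbC K α β γ δ (n := n)) = ∑ l : Fin (n + 1), (α + l₁ * γ) ^ (n - (l : ℕ)) * (δ - l₁ * γ) ^ (l : ℕ) := by
  rw [LinearMap.trace_eq_matrix_trace K (spikeBasis K n), toMatrix_SbC, trace_sbMat_of_fixed_one K e₁]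

/-- **THE CHARACTERISTIC POLYNOMIAL OF THE SUBSTITUTION ON THE CLASS SPACE for a fixed node `λ₁ ∈ K`: `Π_{l=0}^{n} (X − C((α+λ₁γ)^{n−l}(δ−λ₁γ)^l))`** (I9, basis-free). -/
theorem charpoly_SbC_of_fixed_one {α β γ δ l₁ : K} (e₁ : β + l₁ * δ = l₁ * (α + l₁ * γ)) :
    (SbC K α β γ δ (n := n)).charpoly = ∏ l : Fin (n + 1), (Polynomial.X - Polynomial.C ((α + l₁ * γ) ^ (n - (l : ℕ)) * (δ - l₁ * γ) ^ (l : ℕ))) := by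
  rw [← LinearMap.charpoly_toMatrix _ (spikeBasis K n), toMatrix_SbC, charpoly_sbMat_of_fixed_one K e₁]

/-- the shear on the class space: `charpoly = (X − 1)^{n+1}` (I9). -/
theorem charpoly_SbC_shear (lam : K) : (SbC K 1 lam 0 1 (n := n)).charpoly = (Polynomial.X - Polynomial.C 1) ^ (n + 1) := by
  rw [← LinearMap.charpoly_toMatrix _ (spikeBasis K n), toMatrix_SbC, charpoly_sbMat_shear]

/-- two distinct fixed nodes: `charpoly (Sb g | classes) = Π_l (X − C((α+λ₁γ)^{n−l}(α+λ₂γ)^l))` (I9; I6's eigenbasis basis-free). -/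
theorem charpoly_SbC_of_fixed_two {α β γ δ l₁ l₂ : K} (h₁₂ : l₁ ≠ l₂) (e₁ : β + l₁ * δ = l₁ * (α + l₁ * γ)) (e₂ : β + l₂ * δ = l₂ * (α + l₂ * γ)) :
    (SbC K α β γ δ (n := n)).charpoly = ∏ l : Fin (n + 1), (Polynomial.X - Polynomial.C ((α + l₁ * γ) ^ (n - (l : ℕ)) * (α + l₂ * γ) ^ (l : ℕ))) := by
  rw [← LinearMap.charpoly_toMatrix _ (spikeBasis K n), toMatrix_SbC, charpoly_sbMat_of_fixed_two K h₁₂ e₁ e₂]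

end Summit.Ventures.HSemireg.Wedge.HankelFrameChange
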